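import Literature.MathematicalPhysics.QuantumLattice.DWaveSource
import Literature.MathematicalPhysics.QuantumLattice.XYOrder
import Literature.MathematicalPhysics.QuantumLattice.HubbardScaleReportCT
import Literature.MathematicalPhysics.QuantumLattice.SymmetricRegimeCertificateT
import Summits.HubbardSuperconductivity.HubbardSuperconductivity.Theses.AposterioriCapRg
import HarnessLib
import Literature.MathematicalPhysics.QuantumLattice.AnomalousBlockFloorHyp

/-!
# `¬ SeededBrokenRegimeBoseFermiPinned` modulo a remainder floor at the certified points
# (crux [3] of route AposterioriCapRg = stmt-HubbardSuperconductivity-14047; negative lemma, `--negative-modulo`)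

The standing disprover's cycle-2/3 finding F1 (Cruxes/SeededBrokenRegimeBoseFermiPinned/Disproof.lean §9, FLOOR_c2.md v4;
its own landing attempts p80926/p80918 bounced on relocation, cycle 3 could not reach the gate), landed here by the line lead c2
in relocation-safe form (explicit Literature imports, no `open`, the hypothesis fully qualified and self-contained).

* `AnomalousBlockFloorHyp` — ONE closed `Prop`: some `c > 0` such that for every tolerance `Θ` there is a point `(U, δ, μ)` of
  the box carrying the density clause and a `v3` certificate, at which every scale datum with a patch that is `h`-uniformly
  certified against the CT report on some `(0, h₀]` has remainder ceiling `≥ c` — unless it fails the unit stiffness thresholds for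
  every remainder budget.  Physically EXPECTED as the report D1″ is typed (the anomalous `B₁g` block `½V_⊥(q)(BB + B̄B̄)` of the
  transverse pair exchange is not kept by `cooperKeptCT` and is marginal in `scaledRemainderNormCT`, `c_W ≈ 0.027/v_F²`), but NOT
  constructible in the tree: it contains a certified point (the weak producer `[2′]`) and a floor theorem for the interacting model.
* `SeededBrokenRegimeBoseFermiPinned_false_of_AnomalousBlockFloorHyp : Literature.MathematicalPhysics.QuantumLattice.AnomalousBlockFloorHyp → ¬ SeededBrokenRegimeBoseFermiPinned`
  (`kStar := 1`, `etaStar :=` a rational in `(0, c)`; the reported remainder ceiling `≤ etaStar < c` contradicts the floor).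

Pure logic over the tree's definitions; no model content.  Sources: the definitions (`HubbardScaleData`, `hubbardScaleReportCT`,
`symmetricRegimeCertificateT`; a-posteriori format Figueras–Haro–Luque 2016 Thm. 2.5) and the disprover's work file.
-/

set_option linter.dupNamespace false -- `Summit.<S>.<S>` doubles the summit name (tree convention)

namespace Summit.HubbardSuperconductivity.HubbardSuperconductivity.Theorems.SeededBrokenRegimeBoseFermiPinned.Negative

/-- **THE NEGATIVE LEMMA: a positive remainder floor at the certified points refutes crux `[3]`.**  Under
`AnomalousBlockFloorHyp` (floor `c > 0`), take `kStar := 1` and a rational `etaStar ∈ (0, c)`; the crux yields a tolerance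
`Θ`; the hypothesis yields a certified point of the box at which the crux's conclusion gives a datum meeting
`MeetsThresholds 1 etaStar` (so `remainderNorm.snd ≤ etaStar < c`) that is `h`-uniformly certified — contradicting the floor
(or the "meets no unit threshold" alternative). [folklore] -/
theorem SeededBrokenRegimeBoseFermiPinned_false_of_AnomalousBlockFloorHyp (hH : Literature.MathematicalPhysics.QuantumLattice.AnomalousBlockFloorHyp) :
    ¬ Summit.HubbardSuperconductivity.HubbardSuperconductivity.Theses.AposterioriCapRg.SeededBrokenRegimeBoseFermiPinned := by
  intro hS
  obtain ⟨c, hc, hfloor⟩ := hH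
  obtain ⟨η, hη0, hηc⟩ := exists_rat_btwn hc
  have hη0' : (0 : ℚ) < η := by exact_mod_cast hη0
  obtain ⟨Θ, hΘ⟩ := hS 1 η one_pos hη0'
  obtain ⟨U, hU, δ, hδ, μ, hd, ⟨K, Λ, L₀, hcert⟩, h₁, hh₁, hfl⟩ := hfloor Θ
  obtain ⟨h₀, hh₀, D, hmeets, hNp, -, hencl⟩ := hΘ U hU δ hδ μ hd K Λ L₀ hcert
  rcases hfl D (min h₀ h₁) (lt_min hh₀ hh₁) (min_le_right _ _) hNp
      (fun h hh => hencl h ⟨hh.1, hh.2.trans (min_le_left _ _)⟩) with hcle | hno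
  · have h5 : D.remainderNorm.snd ≤ η :=
      (hmeets : D.MeetsThresholdsWith 10 1 η).2.2.2.2.2.2.2
    have h5' : ((D.remainderNorm.snd : ℚ) : ℝ) ≤ η := by exact_mod_cast h5
    linarith
  · exact hno η hmeets

end Summit.HubbardSuperconductivity.HubbardSuperconductivity.Theorems.SeededBrokenRegimeBoseFermiPinned.Negative
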